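import Summits.RiemannHypothesis.RiemannHypothesis.Theses.RuelleBand
import Summits.RiemannHypothesis.RiemannHypothesis.Theorems.RuelleBandZetaWeakRecurrenceStubRecurrenceOfApproximant
import Summits.RiemannHypothesis.RiemannHypothesis.Theorems.RuelleBandZetaWeakRecurrenceStubApproximantOfNoInteriorZero
import Literature.Barriers.RiemannHypothesis.BohrDenseValuesProofs
import HarnessLib

/-!
# `RuelleBand.ZetaWeakRecurrence` — line `Sketch` (reshaped skeleton)
(crux stmt-RiemannHypothesis-18110, route route-RiemannHypothesis-RuelleBand)

WR (the crux): on every closed disc `|s − z| ≤ r` of the half-strip `1/2 < σ < 1`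
(`0 < r < min (Re z − 1/2, 1 − Re z)`), for every `ε > 0` and every height `T` some vertical shift
`τ ≥ T` satisfies `max_{|s−z|≤r} |ζ(s+iτ) − ζ(s)| < ε`.

Composition `ZetaWeakRecurrence_of` (sorries only in `stub_*`): for a disc `D = closedBall z r` and
a level `ε`, EITHER
* (approximable regime) there is a function `g`, holomorphic on a larger disc `ball z R` and
  zero-free on `D`, with `|ζ − g| ≤ ε − η` on `D` for some `η > 0`; then Bagchi/Voronin disc
  universality for the target `g` (tree: `Steuding2007_thm1_9_discAnalytic_holds`, PROVED) returns
  `ζ(·+iτ)` to within `η` of `g`, hence within `ε` of `ζ`, for a set of `τ` of positive lower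
  density, in particular beyond every height — `stub_recurrence_of_approximant` (provable, M);
* OR not; then `ζ` has a zero in the OPEN disc `ball z r` (contrapositive of
  `stub_approximant_of_noInteriorZero`: if `ζ ≠ 0` on `ball z r`, the contraction
  `g(s) = ζ(z + (1−θ)(s−z))`, `0 < θ` small, is zero-free on `D`, holomorphic on a larger disc and
  uniformly close to `ζ` on `D` — provable, M), and we are in the ROUCHÉ REGIME: every `ε`-return
  generates a zero of `ζ` near the shifted interior zero (tree `exists_zero_near_shift`). This is
  the line's open content `stub_roucheRegime`, stated in elementary form; the line's intended
  supplier is the invariant-measure transfer `(M_D) ⟹ stub_roucheRegime` (Poincaré recurrence for a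
  shift-invariant probability measure on the orbit closure of `ζ` in `C(Strip, ℂ)` charging the
  `ε`-sup-neighbourhood of `ζ|_D`; `Cruxes/ZetaWeakRecurrence/SketchIdeator1.lean`,
  `zetaWeakRecurrence_of_invariantMeasure`, kernel-checked).

Honest label: `stub_roucheRegime` implies the route's open glue `CofiniteToExact`
(a late return near an isolated off-line zero generates a new off-line zero above every height),
i.e. Bombieri's zero-or-infinity dichotomy; it is RH-implied and not known to be RH-equivalent.
-/

-- D-0017: single-problem summit; the lakefile turns this linter off for `Summits`; repeated here so that
-- standalone elaboration is warning-free as well.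
set_option linter.dupNamespace false

noncomputable section

open Complex Set Metric Filter Topology MeasureTheory

namespace Summit.RiemannHypothesis.RiemannHypothesis.Theorems.RuelleBandZetaWeakRecurrence

open Summit.RiemannHypothesis.RiemannHypothesis.Theses.RuelleBand
open Literature.Barriers.RiemannHypothesis Literature.NumberTheory.LFunctions

-- Stub 1 `stub_recurrence_of_approximant` — LANDED p142150
--   (Theorems/RuelleBandZetaWeakRecurrenceStubRecurrenceOfApproximant.lean, imported).
-- Stub 2 `stub_approximant_of_noInteriorZero` — LANDED p142211
--   (Theorems/RuelleBandZetaWeakRecurrenceStubApproximantOfNoInteriorZero.lean, imported).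

/-- **Stub 3 (THE ROUCHÉ REGIME — the line's open content).**
On a closed disc of the half-strip containing a zero of `ζ` in its interior, at a level `ε` so
small that NO zero-free holomorphic approximant within `ε − η` exists (so that every `ε`-return of
`ζ(·+iτ)` to `ζ` generates, by Rouché, a zero of `ζ` near the shifted interior zero), the returns
are nevertheless unbounded above. RH-implied (vacuous under RH); implies the zero-or-infinity
dichotomy for off-line zeros near every abscissa; intended supplier: a shift-invariant probability
measure on the orbit closure of `ζ` charging the `ε`-sup-neighbourhood of `ζ|_D` (Poincaré). -/
theorem stub_roucheRegime :
    ∀ (z : ℂ) (r : ℝ), 0 < r → r < min (z.re - 1 / 2) (1 - z.re) →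
      (∃ ξ ∈ Metric.ball z r, riemannZeta ξ = 0) → ∀ ε : ℝ, 0 < ε →
      (¬ ∃ (R η : ℝ) (g : ℂ → ℂ), r < R ∧ 0 < η ∧ DifferentiableOn ℂ g (Metric.ball z R) ∧
        (∀ s ∈ Metric.closedBall z r, g s ≠ 0) ∧
        ∀ s ∈ Metric.closedBall z r, ‖riemannZeta s - g s‖ ≤ ε - η) →
      ∀ T : ℝ, ∃ τ : ℝ, T ≤ τ ∧
        ∀ s ∈ Metric.closedBall z r, ‖riemannZeta (s + ↑τ * Complex.I) - riemannZeta s‖ < ε := by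
  sorry

/-- **Composition.** `ZetaWeakRecurrence` from the three stubs: split on the existence of a
zero-free holomorphic `(ε − η)`-approximant on the disc; if there is none, Stub 2 (contrapositive)
produces an interior zero and Stub 3 applies. -/
theorem ZetaWeakRecurrence_of : ZetaWeakRecurrence := by
  intro z r hr hrmin ε hε T
  by_cases hA : ∃ (R η : ℝ) (g : ℂ → ℂ), r < R ∧ 0 < η ∧ DifferentiableOn ℂ g (Metric.ball z R) ∧
      (∀ s ∈ Metric.closedBall z r, g s ≠ 0) ∧
      ∀ s ∈ Metric.closedBall z r, ‖riemannZeta s - g s‖ ≤ ε - η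
  · exact stub_recurrence_of_approximant z r hr hrmin ε hε hA T
  · have hξ : ∃ ξ ∈ Metric.ball z r, riemannZeta ξ = 0 := by
      by_contra hno
      push Not at hno
      exact hA (stub_approximant_of_noInteriorZero z r hr hrmin hno ε hε)
    exact stub_roucheRegime z r hr hrmin hξ ε hε hA T

end Summit.RiemannHypothesis.RiemannHypothesis.Theorems.RuelleBandZetaWeakRecurrence

end
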